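import Mathlib
import HarnessLib
import Summits.AtomisticToContinuum.FouriersLaw.Theses.JunctionLocality
import Summits.AtomisticToContinuum.FouriersLaw.Theorems.JunctionLocalitySuperadditiveResistanceKuboDefinite

/-!
# Kubo–Onsager for the γ-thermostatted pinned chain, IX: kernel = constants, reciprocity and the sum rule

Helper file (`--supports` stmt-AtomisticToContinuum-11748) for stub `stub_kuboOnsager` of the line
`floating-probe-bypass-laplacian` (crux `JunctionLocality.SuperadditiveResistance`). Terminal frame of part VIII
(`m` terminals on distinct sites `s`, `B = termWeight s`, friction `c > 0`, fields `g_a` with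
`σ X_H g_a + c S_B g_a = −(p_{s_a}² − T)`).

* `theta_const_of_extremal` — KERNEL = CONSTANTS: if `∫ g_θ k_θ ρ = (T²/c)|θ|² ∫ρ` (equality in part VIII), `σ ≠ 0`
  and one terminal sits on site `0`, then `θ` is constant. Mechanism: part VIII gives
  `∂_{p_{s_a}} g_θ = (θ_a/c) p_{s_a}`, whence `c S_B g_θ = −k_θ`, so `X_H g_θ = 0`; then
  `v = g_θ − (θ_{a₀}/c) H` is a `C²` first integral of `X_H` not depending on `p_0`, and the landed propagation
  `fderiv_eq_zero_of_liouville` (Hörmander bracket mechanism, `V'' = 1 + 3βr² ≠ 0`) forces `Dv = 0`, i.e.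
  `(θ_a − θ_{a₀}) p_{s_a} ≡ 0`.
* `kuboPair_symm` — ONSAGER RECIPROCITY `∫ g_a (p_{s_b}² − T) ρ = ∫ g_b (p_{s_a}² − T) ρ` (part V).
* `sum_kuboPair` — the SUM RULE `Σ_b ∫ g_a (p_{s_b}² − T) ρ = (T²/c) ∫ ρ` (energy conservation: `X_H H = 0`,
  `c S_B H = −c Σ_b (p_{s_b}² − T)`, reciprocity against `H`, and `∫ (p² − T) H ρ = T² ∫ ρ`), which is the
  zero-row-sum property of the Kubo matrix.
* `kubo_onsager_terminal` — the ABSTRACT KUBO–ONSAGER THEOREM in the terminal frame: a matrix with entries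
  `K_ab = c δ_ab − (c²/T²) ∫ g_a (p_{s_b}² − T) dμ_T` (`= ∂(power of bath a)/∂T_b` at equilibrium) is an ONSAGER
  LAPLACIAN — symmetric (reciprocity), zero row sums (energy conservation), positive semidefinite (second law) with
  kernel exactly the constant vectors (strict entropy production off equilibrium at first order). The stub file of
  the line instantiates it for the four-terminal probe device.
References: Onsager 1931; Eckmann–Pillet–Rey-Bellet 1999 §3; Rey-Bellet 2003 Rem. 4.4 (finite-volume Kubo formula);
folklore.
-/

noncomputable section

open MeasureTheory Filter Topology ProbabilityTheory
open scoped ContDiff NNReal ENNReal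
open Literature.MathematicalPhysics.KineticTheory.HeatConduction
open Summit.AtomisticToContinuum.FouriersLaw.Theorems.SuperadditiveResistance.DeviceLiouville

namespace Summit.AtomisticToContinuum.FouriersLaw.Theorems.SuperadditiveResistance.Kubo

section Hamiltonian

variable (P : OscillatorChain) {L : ℕ}

/-- `X_H H = 0` (energy conservation of the Hamiltonian part). [folklore] -/
theorem liouvilleOp_hamiltonian (x : PhaseSpace L) : liouvilleOp P L (P.hamiltonian L) x = 0 := by
  unfold liouvilleOp
  refine Finset.sum_eq_zero fun i _ => ?_
  rw [P.partialP_hamiltonian]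
  ring

/-- `∂²_{p_i} H = 1`. [folklore] -/
theorem partialP_partialP_hamiltonian (i : Fin L) (x : PhaseSpace L) :
    partialP i (partialP i (P.hamiltonian L)) x = 1 := by
  have h : partialP i (P.hamiltonian L) = fun y : PhaseSpace L => y.2 i := funext fun y => P.partialP_hamiltonian L y i
  rw [h, partialP_snd_self]

/-- `S_B H = Σ_i B_i (T − p_i²)`: each thermostat pumps `T − p_i²` into the energy. [folklore] -/
theorem bathOp_hamiltonian (B : Fin L → ℝ) (T : ℝ) (x : PhaseSpace L) :
    bathOp L B T (P.hamiltonian L) x = ∑ i, B i * (T - x.2 i ^ 2) := by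
  unfold bathOp
  refine Finset.sum_congr rfl fun i _ => ?_
  rw [partialP_partialP_hamiltonian, P.partialP_hamiltonian]
  ring

/-- **The Hamiltonian is a field for the total heating**: `σ X_H H + c S_B H = −(c Σ_i B_i (p_i² − T))` for every
`σ`. [folklore] -/
theorem hamiltonian_pair (B : Fin L → ℝ) (T σ c : ℝ) (x : PhaseSpace L) :
    σ * liouvilleOp P L (P.hamiltonian L) x + c * bathOp L B T (P.hamiltonian L) x =
      -(c * ∑ i, B i * (x.2 i ^ 2 - T)) := by
  rw [liouvilleOp_hamiltonian, bathOp_hamiltonian, mul_zero, zero_add, Finset.mul_sum, Finset.mul_sum,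
    ← Finset.sum_neg_distrib]
  refine Finset.sum_congr rfl fun i _ => ?_
  ring

end Hamiltonian

section Kernel

variable {ω₂ lam β γ : ℝ} {L m : ℕ}

set_option hygiene false in
/-- Local shorthand for the pinned chain of this section. -/
local notation "𝐏" => pinnedChain ω₂ lam β γ

/-- **Kernel = constants.** In the terminal frame with `σ ≠ 0` and a terminal `a₀` on site `0`: if
`∫ g_θ k_θ ρ = (T²/c)|θ|² ∫ ρ` then `θ_a = θ_{a₀}` for every terminal `a`. [folklore] -/
theorem theta_const_of_extremal (hω : 0 < ω₂) (hl : 0 ≤ lam) (hβ : 0 ≤ β) {L : ℕ} (hL : 0 < L) {T : ℝ}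
    (hT : 0 < T) (s : Fin m → Fin L) (hs : Function.Injective s) {a₀ : Fin m} (hs0 : s a₀ = ⟨0, hL⟩)
    {σ : ℝ} (hσ : σ ≠ 0) {c : ℝ} (hc : 0 < c)
    {g : Fin m → PhaseSpace L → ℝ} (hg : ∀ a, ContDiff ℝ 2 (g a)) (hgL : ∀ a, MemLp (g a) 2 ((𝐏).gibbsMeasure L T))
    (hpde : ∀ a x, σ * liouvilleOp 𝐏 L (g a) x + c * bathOp L (termWeight s) T (g a) x = -(x.2 (s a) ^ 2 - T))
    (θ : Fin m → ℝ)
    (hext : ∫ x, comb θ g x * comb θ (fun a y => y.2 (s a) ^ 2 - T) x * (𝐏).gibbsDensity L T x =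
      T ^ 2 / c * (∑ a, θ a ^ 2) * ∫ x, (𝐏).gibbsDensity L T x) (a : Fin m) :
    θ a = θ a₀ := by
  have hU : ContDiff ℝ ∞ (𝐏).U := pinnedChain_contDiff_U ω₂ lam β γ
  have hV : ContDiff ℝ ∞ (𝐏).V := pinnedChain_contDiff_V ω₂ lam β γ
  have hV2 : ∀ r, deriv (deriv (𝐏).V) r ≠ 0 := fun r => by
    rw [pinnedChain_deriv_deriv_V]; positivity
  -- step 1: the terminal momentum derivatives of g_θ
  have hpt : ∀ b x, partialP (s b) (comb θ g) x = θ b / c * x.2 (s b) := fun b x =>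
    partialP_comb_eq_of_extremal hω hl hβ L hT s hs σ hc hg hgL hpde θ hext b x
  have hgθ : ContDiff ℝ 2 (comb θ g) := contDiff_comb θ hg
  have hgθd : Differentiable ℝ (comb θ g) := hgθ.differentiable two_ne_zero
  -- step 2: c S_B g_θ = -k_θ, hence X_H g_θ = 0
  have hS : ∀ x, c * bathOp L (termWeight s) T (comb θ g) x = -comb θ (fun b y => y.2 (s b) ^ 2 - T) x := by
    intro x
    have e : bathOp L (termWeight s) T (comb θ g) x =
        ∑ b, (T * partialP (s b) (partialP (s b) (comb θ g)) x - x.2 (s b) * partialP (s b) (comb θ g) x) := by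
      unfold bathOp
      exact sum_termWeight_mul s fun i => T * partialP i (partialP i (comb θ g)) x - x.2 i * partialP i (comb θ g) x
    rw [e, comb_apply, Finset.mul_sum, ← Finset.sum_neg_distrib]
    refine Finset.sum_congr rfl fun b _ => ?_
    have h1 : partialP (s b) (comb θ g) = fun y : PhaseSpace L => θ b / c * y.2 (s b) := funext (hpt b)
    rw [h1, partialP_const_mul_snd]
    field_simp
    ring
  have hX : ∀ x, liouvilleOp 𝐏 L (comb θ g) x = 0 := by
    intro x
    have e := comb_pair (pinnedChain ω₂ lam β γ) (termWeight s) T σ c θ hg hpde x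
    rw [hS x] at e
    have : σ * liouvilleOp 𝐏 L (comb θ g) x = 0 := by linarith
    exact (mul_eq_zero.mp this).resolve_left hσ
  -- step 3: v = g_θ - (θ a₀ / c) H is a C² first integral of X_H, independent of p_0
  set v : PhaseSpace L → ℝ := comb ![1, -(θ a₀ / c)] ![comb θ g, (𝐏).hamiltonian L] with hv
  have hHs : ContDiff ℝ ∞ ((𝐏).hamiltonian L) := (𝐏).contDiff_hamiltonian hU hV L
  have hH2 : ContDiff ℝ 2 ((𝐏).hamiltonian L) := hHs.of_le (by norm_cast)
  have hmem2 : ∀ j : Fin 2, ContDiff ℝ 2 ((![comb θ g, (𝐏).hamiltonian L] : Fin 2 → PhaseSpace L → ℝ) j) := by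
    intro j; fin_cases j
    · exact hgθ
    · exact hH2
  have hmemd : ∀ j : Fin 2, Differentiable ℝ ((![comb θ g, (𝐏).hamiltonian L] : Fin 2 → PhaseSpace L → ℝ) j) :=
    fun j => (hmem2 j).differentiable two_ne_zero
  have hv2 : ContDiff ℝ 2 v := contDiff_comb _ hmem2
  have hvd : Differentiable ℝ v := hv2.differentiable two_ne_zero
  have hXv : ∀ x, fderiv ℝ v x (hamField 𝐏 L x) = 0 := by
    intro x
    rw [← liouvilleOp_eq_fderiv 𝐏 (hU.differentiable (by simp)) (hV.differentiable (by simp)) hvd,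
      hv, liouvilleOp_comb 𝐏 _ hmemd]
    simp [Fin.sum_univ_two, hX x, liouvilleOp_hamiltonian]
  have hPv : ∀ (i : Fin L) (x : PhaseSpace L),
      partialP i v x = partialP i (comb θ g) x - θ a₀ / c * x.2 i := by
    intro i x
    rw [hv, partialP_comb _ hmemd]
    simp [Fin.sum_univ_two, (𝐏).partialP_hamiltonian]
    ring
  have h0 : ∀ x, fderiv ℝ v x (unitP ⟨0, hL⟩) = 0 := by
    intro x
    have e := congr_fun (partialP_eq_fderiv hvd ⟨0, hL⟩) x
    rw [unitP_eq, ← e, hPv, ← hs0, hpt a₀ x]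
    ring
  have hD : ∀ x, fderiv ℝ v x = 0 := fderiv_eq_zero_of_liouville hU hV hV2 hL hv2 hXv h0
  -- step 4: read off θ_a = θ_{a₀} at a point with p_{s a} = 1
  set x₁ : PhaseSpace L := ((fun _ => 0), fun _ => 1) with hx₁
  have e1 : partialP (s a) v x₁ = 0 := by
    have e := congr_fun (partialP_eq_fderiv hvd (s a)) x₁
    rw [e, hD x₁]
    rfl
  rw [hPv, hpt a x₁] at e1
  simp only [hx₁, mul_one] at e1
  field_simp at e1
  linarith

/-- The kinetic sources are even in the momenta. [folklore] -/
theorem rev_kinetic (s : Fin L) (T : ℝ) : rev (fun y : PhaseSpace L => y.2 s ^ 2 - T) = fun y => y.2 s ^ 2 - T := by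
  funext y; simp [rev]

/-- **Onsager reciprocity in the terminal frame**: `∫ g_a (p_{s_b}² − T) ρ = ∫ g_b (p_{s_a}² − T) ρ`. [folklore] -/
theorem kuboPair_symm (hω : 0 < ω₂) (hl : 0 ≤ lam) (hβ : 0 ≤ β) (L : ℕ) {T : ℝ} (hT : 0 < T)
    (s : Fin m → Fin L) (σ : ℝ) {c : ℝ} (hc : 0 < c)
    {g : Fin m → PhaseSpace L → ℝ} (hg : ∀ a, ContDiff ℝ 2 (g a)) (hgL : ∀ a, MemLp (g a) 2 ((𝐏).gibbsMeasure L T))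
    (hpde : ∀ a x, σ * liouvilleOp 𝐏 L (g a) x + c * bathOp L (termWeight s) T (g a) x = -(x.2 (s a) ^ 2 - T))
    (a b : Fin m) :
    ∫ x, g a x * (x.2 (s b) ^ 2 - T) * (𝐏).gibbsDensity L T x =
      ∫ x, g b x * (x.2 (s a) ^ 2 - T) * (𝐏).gibbsDensity L T x :=
  onsager_symmetry hω hl hβ L hT (termWeight s) (termWeight_nonneg s) σ hc (hg b) (hg a) (hgL b) (hgL a)
    (memLp_kinetic hω hl hβ L hT (s b)) (memLp_kinetic hω hl hβ L hT (s a)) (rev_kinetic (s b) T)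
    (rev_kinetic (s a) T) (hpde b) (hpde a)

/-- **Sum rule (energy conservation)**: `Σ_b ∫ g_a (p_{s_b}² − T) ρ = (T²/c) ∫ ρ`. [folklore] -/
theorem sum_kuboPair (hω : 0 < ω₂) (hl : 0 ≤ lam) (hβ : 0 ≤ β) (L : ℕ) {T : ℝ} (hT : 0 < T)
    (s : Fin m → Fin L) (σ : ℝ) {c : ℝ} (hc : 0 < c)
    {g : Fin m → PhaseSpace L → ℝ} (hg : ∀ a, ContDiff ℝ 2 (g a)) (hgL : ∀ a, MemLp (g a) 2 ((𝐏).gibbsMeasure L T))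
    (hpde : ∀ a x, σ * liouvilleOp 𝐏 L (g a) x + c * bathOp L (termWeight s) T (g a) x = -(x.2 (s a) ^ 2 - T))
    (a : Fin m) :
    ∑ b, ∫ x, g a x * (x.2 (s b) ^ 2 - T) * (𝐏).gibbsDensity L T x = T ^ 2 / c * ∫ x, (𝐏).gibbsDensity L T x := by
  have hU : ContDiff ℝ ∞ (𝐏).U := pinnedChain_contDiff_U ω₂ lam β γ
  have hV : ContDiff ℝ ∞ (𝐏).V := pinnedChain_contDiff_V ω₂ lam β γ
  have hH2 : ContDiff ℝ 2 ((𝐏).hamiltonian L) := ((𝐏).contDiff_hamiltonian hU hV L).of_le (by norm_cast)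
  -- the Hamiltonian as a field for the total heating K_H = c Σ_i B_i (p_i² − T)
  set KH : PhaseSpace L → ℝ := fun x => c * ∑ i, termWeight s i * (x.2 i ^ 2 - T) with hKH
  have hHpde : ∀ x, σ * liouvilleOp 𝐏 L ((𝐏).hamiltonian L) x + c * bathOp L (termWeight s) T ((𝐏).hamiltonian L) x =
      -KH x := fun x => hamiltonian_pair (pinnedChain ω₂ lam β γ) (termWeight s) T σ c x
  have hKH_even : rev KH = KH := by funext y; simp [rev, hKH]
  have hKH2 : MemLp KH 2 ((𝐏).gibbsMeasure L T) := by
    have : MemLp (fun x => ∑ i, termWeight s i * (x.2 i ^ 2 - T)) 2 ((𝐏).gibbsMeasure L T) :=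
      memLp_finsetSum _ fun i _ => (memLp_kinetic hω hl hβ L hT i).const_mul _
    exact this.const_mul c
  have hsym := onsager_symmetry hω hl hβ L hT (termWeight s) (termWeight_nonneg s) σ hc (hg a) hH2 (hgL a)
    (memLp_hamiltonian hω hl hβ L hT) (memLp_kinetic hω hl hβ L hT (s a)) hKH2 (rev_kinetic (s a) T) hKH_even
    (hpde a) hHpde
  -- left side of reciprocity: ∫ H (p_{s a}² − T) ρ = T² Z
  have hLHS : ∫ x, (𝐏).hamiltonian L x * (x.2 (s a) ^ 2 - T) * (𝐏).gibbsDensity L T x =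
      T ^ 2 * ∫ x, (𝐏).gibbsDensity L T x := by
    rw [← integral_kinetic_mul_hamiltonian_mul_gibbsDensity hω hl hβ L hT (s a)]
    exact integral_congr_ae (ae_of_all _ fun x => by ring)
  -- right side: ∫ g_a K_H ρ = c Σ_b ∫ g_a (p_{s b}² − T) ρ
  have hI : ∀ i, Integrable fun x => g a x * (x.2 i ^ 2 - T) * (𝐏).gibbsDensity L T x := fun i =>
    integrable_mul_mul_gibbsDensity hω hl hβ γ L hT (hgL a) (memLp_kinetic hω hl hβ L hT i)
  have hRHS : ∫ x, g a x * KH x * (𝐏).gibbsDensity L T x =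
      c * ∑ b, ∫ x, g a x * (x.2 (s b) ^ 2 - T) * (𝐏).gibbsDensity L T x := by
    have hpt : (fun x => g a x * KH x * (𝐏).gibbsDensity L T x) =
        fun x => ∑ i, c * termWeight s i * (g a x * (x.2 i ^ 2 - T) * (𝐏).gibbsDensity L T x) := by
      funext x
      simp only [hKH, Finset.mul_sum, Finset.sum_mul]
      refine Finset.sum_congr rfl fun i _ => ?_
      ring
    rw [hpt, integral_finsetSum _ fun i _ => (hI i).const_mul _]
    have e2 : ∀ i, ∫ x, c * termWeight s i * (g a x * (x.2 i ^ 2 - T) * (𝐏).gibbsDensity L T x) =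
        c * (termWeight s i * ∫ x, g a x * (x.2 i ^ 2 - T) * (𝐏).gibbsDensity L T x) := fun i => by
      rw [integral_const_mul]; ring
    simp only [e2, ← Finset.mul_sum]
    rw [sum_termWeight_mul s fun i => ∫ x, g a x * (x.2 i ^ 2 - T) * (𝐏).gibbsDensity L T x]
  rw [hLHS, hRHS] at hsym
  have hc0 : c ≠ 0 := hc.ne'
  field_simp
  linarith

end Kernel

section Terminal

variable {ω₂ lam β γ : ℝ} {L m : ℕ}

set_option hygiene false in
/-- Local shorthand for the pinned chain of this section. -/
local notation "𝐏" => pinnedChain ω₂ lam β γ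

/-- Expansion of the quadratic form of `c·1 − κ M`. [folklore] -/
theorem quadForm_expand (c κ : ℝ) (M : Fin m → Fin m → ℝ) (θ : Fin m → ℝ) :
    ∑ a, ∑ b, θ a * ((if a = b then c else 0) - κ * M a b) * θ b =
      c * ∑ a, θ a ^ 2 - κ * ∑ a, ∑ b, θ a * θ b * M a b := by
  have e : ∀ a, ∑ b, θ a * ((if a = b then c else 0) - κ * M a b) * θ b =
      c * θ a ^ 2 - κ * ∑ b, θ a * θ b * M a b := by
    intro a
    have e1 : ∀ b, θ a * ((if a = b then c else 0) - κ * M a b) * θ b =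
        (if a = b then c * θ a ^ 2 else 0) - κ * (θ a * θ b * M a b) := by
      intro b
      split_ifs with h
      · subst h; ring
      · ring
    simp only [e1, Finset.sum_sub_distrib, Finset.sum_ite_eq, Finset.mem_univ, if_true, Finset.mul_sum]
  simp only [e, Finset.sum_sub_distrib, Finset.mul_sum]

/-- The partition function normalises: `Z⁻¹ · Z = 1` for `Z = ∫ e^{-H/T}` (`T > 0`). [folklore] -/
theorem inv_partition_mul (hω : 0 < ω₂) (hl : 0 ≤ lam) (hβ : 0 ≤ β) (L : ℕ) {T : ℝ} (hT : 0 < T) :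
    (∫ x, (𝐏).gibbsDensity L T x)⁻¹ * ∫ x, (𝐏).gibbsDensity L T x = 1 := by
  haveI := pinnedChain_isProbabilityMeasure_gibbsMeasure hω hl hβ γ L hT
  have h := (𝐏).integral_gibbsMeasure (T := T) (N := L) (fun _ => (1 : ℝ))
  simp only [integral_const, probReal_univ, smul_eq_mul, mul_one, one_mul] at h
  exact h.symm

/-- `0 < Z`. [folklore] -/
theorem partition_pos (hω : 0 < ω₂) (hl : 0 ≤ lam) (hβ : 0 ≤ β) (L : ℕ) {T : ℝ} (hT : 0 < T) :
    0 < ∫ x, (𝐏).gibbsDensity L T x :=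
  integral_exp_pos (pinnedChain_integrable_gibbsDensity hω hl hβ γ L hT)

/-- **KUBO–ONSAGER THEOREM (terminal frame).** Under the hypotheses of the module docstring, a matrix `K` with
entries `K_ab = c δ_ab − (c²/T²) ∫ g_a (p_{s_b}² − T) dμ_T` is symmetric, has zero row sums, is positive
semidefinite, and its quadratic form vanishes only on constant vectors. [folklore] -/
theorem kubo_onsager_terminal (hω : 0 < ω₂) (hl : 0 ≤ lam) (hβ : 0 ≤ β) {L : ℕ} (hL : 0 < L) {T : ℝ}
    (hT : 0 < T) (s : Fin m → Fin L) (hs : Function.Injective s) {a₀ : Fin m} (hs0 : s a₀ = ⟨0, hL⟩)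
    {σ : ℝ} (hσ : σ ≠ 0) {c : ℝ} (hc : 0 < c)
    {g : Fin m → PhaseSpace L → ℝ} (hg : ∀ a, ContDiff ℝ 2 (g a)) (hgL : ∀ a, MemLp (g a) 2 ((𝐏).gibbsMeasure L T))
    (hpde : ∀ a x, σ * liouvilleOp 𝐏 L (g a) x + c * bathOp L (termWeight s) T (g a) x = -(x.2 (s a) ^ 2 - T))
    (K : Matrix (Fin m) (Fin m) ℝ)
    (hK : ∀ a b, K a b = (if a = b then c else 0) -
      c ^ 2 / T ^ 2 * ∫ x, g a x * (x.2 (s b) ^ 2 - T) ∂((𝐏).gibbsMeasure L T)) :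
    K.IsSymm ∧ (∀ a, ∑ b, K a b = 0) ∧ (∀ θ : Fin m → ℝ, 0 ≤ ∑ a, ∑ b, θ a * K a b * θ b) ∧
      (∀ θ : Fin m → ℝ, ∑ a, ∑ b, θ a * K a b * θ b = 0 → ∀ a b, θ a = θ b) := by
  set Z : ℝ := ∫ x, (𝐏).gibbsDensity L T x with hZ
  have hZpos : 0 < Z := partition_pos hω hl hβ L hT
  have hZ1 : Z⁻¹ * Z = 1 := inv_partition_mul hω hl hβ L hT
  set M : Fin m → Fin m → ℝ := fun a b => ∫ x, g a x * (x.2 (s b) ^ 2 - T) * (𝐏).gibbsDensity L T x with hM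
  -- entries in unnormalised form
  have hK' : ∀ a b, K a b = (if a = b then c else 0) - c ^ 2 / T ^ 2 * Z⁻¹ * M a b := by
    intro a b
    rw [hK, (𝐏).integral_gibbsMeasure]
    ring
  -- reciprocity, sum rule, quadratic form
  have hsymM : ∀ a b, M a b = M b a := fun a b => kuboPair_symm hω hl hβ L hT s σ hc hg hgL hpde a b
  have hsumM : ∀ a, ∑ b, M a b = T ^ 2 / c * Z := fun a => sum_kuboPair hω hl hβ L hT s σ hc hg hgL hpde a
  have hquad : ∀ θ : Fin m → ℝ, ∑ a, ∑ b, θ a * K a b * θ b =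
      c * ∑ a, θ a ^ 2 - c ^ 2 / T ^ 2 * Z⁻¹ *
        ∫ x, comb θ g x * comb θ (fun b y => y.2 (s b) ^ 2 - T) x * (𝐏).gibbsDensity L T x := by
    intro θ
    simp only [hK']
    rw [quadForm_expand, integral_comb_mul_comb hω hl hβ L hT θ θ hgL fun b => memLp_kinetic hω hl hβ L hT (s b)]
  have hle : ∀ θ : Fin m → ℝ, ∫ x, comb θ g x * comb θ (fun b y => y.2 (s b) ^ 2 - T) x * (𝐏).gibbsDensity L T x ≤
      T ^ 2 / c * (∑ a, θ a ^ 2) * Z := fun θ => integral_comb_kinetic_le hω hl hβ L hT s hs σ hc hg hgL hpde θ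
  have hc0 : c ≠ 0 := hc.ne'
  have hT0 : T ≠ 0 := hT.ne'
  have hZ0 : Z ≠ 0 := hZpos.ne'
  refine ⟨?_, ?_, ?_, ?_⟩
  · -- symmetry
    refine Matrix.IsSymm.ext fun a b => ?_
    rw [hK' a b, hK' b a, hsymM a b]
    by_cases hab : a = b
    · subst hab; rfl
    · rw [if_neg hab, if_neg (Ne.symm hab)]
  · -- zero row sums
    intro a
    simp only [hK', Finset.sum_sub_distrib, Finset.sum_ite_eq, Finset.mem_univ, if_true, ← Finset.mul_sum, hsumM a]
    field_simp
    ring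
  · -- positive semidefinite
    intro θ
    rw [hquad θ]
    have h1 := hle θ
    have h2 : c ^ 2 / T ^ 2 * Z⁻¹ *
        ∫ x, comb θ g x * comb θ (fun b y => y.2 (s b) ^ 2 - T) x * (𝐏).gibbsDensity L T x ≤
        c ^ 2 / T ^ 2 * Z⁻¹ * (T ^ 2 / c * (∑ a, θ a ^ 2) * Z) :=
      mul_le_mul_of_nonneg_left h1 (by positivity)
    have h3 : c ^ 2 / T ^ 2 * Z⁻¹ * (T ^ 2 / c * (∑ a, θ a ^ 2) * Z) = c * ∑ a, θ a ^ 2 := by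
      field_simp
    linarith
  · -- kernel = constants
    intro θ hθ a b
    rw [hquad θ] at hθ
    have hext : ∫ x, comb θ g x * comb θ (fun b y => y.2 (s b) ^ 2 - T) x * (𝐏).gibbsDensity L T x =
        T ^ 2 / c * (∑ a, θ a ^ 2) * Z := by
      have h3 : c * ∑ a, θ a ^ 2 = c ^ 2 / T ^ 2 * Z⁻¹ * (T ^ 2 / c * (∑ a, θ a ^ 2) * Z) := by
        field_simp
      have h4 : c ^ 2 / T ^ 2 * Z⁻¹ ≠ 0 := by positivity
      have h5 : c ^ 2 / T ^ 2 * Z⁻¹ *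
          ∫ x, comb θ g x * comb θ (fun b y => y.2 (s b) ^ 2 - T) x * (𝐏).gibbsDensity L T x =
          c ^ 2 / T ^ 2 * Z⁻¹ * (T ^ 2 / c * (∑ a, θ a ^ 2) * Z) := by linarith
      exact mul_left_cancel₀ h4 h5
    have ha := theta_const_of_extremal hω hl hβ hL hT s hs hs0 hσ hc hg hgL hpde θ hext a
    have hb := theta_const_of_extremal hω hl hβ hL hT s hs hs0 hσ hc hg hgL hpde θ hext b
    rw [ha, hb]

end Terminal

/-- Registered helper sub-goal `helper_kuboOnsagerTerminal` of stub `stub_kuboOnsager` (= `kubo_onsager_terminal` in stub form; line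
`floating-probe-bypass-laplacian`, crux stmt-AtomisticToContinuum-11748). [folklore] -/
theorem helper_kuboOnsagerTerminal : ∀ {ω₂ lam β γ : ℝ} {m : ℕ}, 0 < ω₂ → 0 ≤ lam → 0 ≤ β → ∀ {L : ℕ} (hL : 0 < L) {T : ℝ}, 0 < T → ∀ (s : Fin m → Fin L), Function.Injective s → ∀ {a₀ : Fin m}, s a₀ = ⟨0, hL⟩ → ∀ {σ : ℝ}, σ ≠ 0 → ∀ {c : ℝ}, 0 < c → ∀ {g : Fin m → PhaseSpace L → ℝ}, (∀ a, ContDiff ℝ 2 (g a)) → (∀ a, MemLp (g a) 2 ((pinnedChain ω₂ lam β γ).gibbsMeasure L T)) → (∀ a x, σ * liouvilleOp (pinnedChain ω₂ lam β γ) L (g a) x + c * bathOp L (termWeight s) T (g a) x = -(x.2 (s a) ^ 2 - T)) → ∀ (K : Matrix (Fin m) (Fin m) ℝ), (∀ a b, K a b = (if a = b then c else 0) - c ^ 2 / T ^ 2 * ∫ x, g a x * (x.2 (s b) ^ 2 - T) ∂((pinnedChain ω₂ lam β γ).gibbsMeasure L T)) → K.IsSymm ∧ (∀ a, ∑ b,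 K a b = 0) ∧ (∀ θ : Fin m → ℝ, 0 ≤ ∑ a, ∑ b, θ a * K a b * θ b) ∧ (∀ θ : Fin m → ℝ, ∑ a, ∑ b, θ a * K a b * θ b = 0 → ∀ a b, θ a = θ b) :=
  @kubo_onsager_terminal

end Summit.AtomisticToContinuum.FouriersLaw.Theorems.SuperadditiveResistance.Kubo

end
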